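import Literature.NumberTheory.LFunctions.LFDSingleGram
import HarnessLib

/-!
# Log-free zero density for one character, IV: scale-averaged weights and the `sinc` factor

Topic `Literature/NumberTheory/LFunctions`, sub-namespace `LFDSingle`. Everything here is PROVED.
In Heath-Brown's single-character duality (PLMS 64 (1992), §11) the Gram entries carry the main
term `(φ(q)/q) D_q(1) Γ(w₁)(X^{w₁} − Y^{w₁})`, `w₁ = 2 − ρ − ρ̄'`, whose modulus decays only like
`1/|γ − γ'|` in the range `1/log q ≤ |γ − γ'| ≤ 1`; a Schur (row-sum) bound then loses a factor
`log log q` against the saturated local zero density. The classical remedy (a smooth cutoff on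
the logarithmic scale `log q`) is implemented here by AVERAGING the exponential weights over the
scales `X R^{-(j+j')/J}`, `0 ≤ j, j' < J`: by linearity the main term acquires the factor
`sincJ R J (w₁)²` with the finite geometric sum

  `sincJ R J s = J⁻¹ Σ_{j<J} R^{-s j/J} = (1 − R^{-s}) / (J (1 − R^{-s/J}))`,

an entire function with `sincJ(0) = 1`, `‖sincJ(s)‖ ≤ 1 + R^{-re s}`, and
`‖sincJ(s)‖ ≤ 2 (1 + R^{-re s})/(‖s‖ log R)` for `‖s‖ log R ≤ J/2` (`norm_sincJ_le_inv`): the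
decay `1/(‖s‖ log R)` on the scale `1/log R ≍ 1/log q` is exactly what makes the row sums
log-free.

## References
* D. R. Heath-Brown, PLMS 64 (1992), §11. [cite: HeathBrown1992PLMS, §11]
-/

noncomputable section

open Finset Real Complex

namespace Literature.NumberTheory.LFunctions.LFDSingle

/-! ### The finite `sinc` factor -/

/-- `sincJ R J s = J⁻¹ Σ_{j < J} R^{-(s j / J)}`. [folklore] -/
def sincJ (R : ℝ) (J : ℕ) (s : ℂ) : ℂ :=
  (J : ℂ)⁻¹ * ∑ j ∈ range J, (R : ℂ) ^ (-(s * j / J))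

/-- `sincJ R J 0 = 1` (`J ≥ 1`). [folklore] -/
theorem sincJ_zero (R : ℝ) {J : ℕ} (hJ : J ≠ 0) : sincJ R J 0 = 1 := by
  have hJ' : (J : ℂ) ≠ 0 := by exact_mod_cast hJ
  simp [sincJ, hJ']

/-- Each term: `‖R^{-(s j/J)}‖ = R^{-(re s) j/J}` (`R > 0`). [folklore] -/
theorem norm_cpow_term (R : ℝ) (hR : 0 < R) (s : ℂ) (j J : ℕ) :
    ‖(R : ℂ) ^ (-(s * j / J))‖ = R ^ (-(s.re * j / J)) := by
  rw [Complex.norm_cpow_eq_rpow_re_of_pos hR]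
  congr 1
  have : -(s * j / J : ℂ) = s * (((-(j : ℝ) / J : ℝ)) : ℂ) := by push_cast; ring
  rw [this, Complex.mul_re, Complex.ofReal_re, Complex.ofReal_im, mul_zero, sub_zero]
  ring

/-- `R^{-(σ j/J)} ≤ 1 + R^{-σ}` for `0 ≤ j ≤ J`, `R ≥ 1`. [folklore] -/
theorem rpow_term_le {R σ : ℝ} (hR : 1 ≤ R) {j J : ℕ} (hjJ : j ≤ J) (hJ : 0 < J) :
    R ^ (-(σ * j / J)) ≤ 1 + R ^ (-σ) := by
  have hR0 : 0 < R := by linarith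
  have ht0 : (0 : ℝ) ≤ j / J := by positivity
  have ht1 : (j : ℝ) / J ≤ 1 := by
    rw [div_le_one (by exact_mod_cast hJ)]; exact_mod_cast hjJ
  rcases le_or_gt 0 σ with hσ | hσ
  · -- `R^{-σ j/J} ≤ 1`
    have : R ^ (-(σ * j / J)) ≤ 1 :=
      Real.rpow_le_one_of_one_le_of_nonpos hR (by
        have : 0 ≤ σ * j / J := by rw [mul_div_assoc]; exact mul_nonneg hσ ht0
        linarith)
    have : 0 ≤ R ^ (-σ) := by positivity
    linarith
  · -- `σ < 0`: `R^{-σ j/J} ≤ R^{-σ}`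
    have h1 : R ^ (-(σ * j / J)) ≤ R ^ (-σ) := by
      refine Real.rpow_le_rpow_of_exponent_le hR ?_
      have : σ * j / J = σ * (j / J) := by ring
      rw [this]
      nlinarith
    linarith

/-- **The trivial bound** `‖sincJ R J s‖ ≤ 1 + R^{-re s}` (`R ≥ 1`, `J ≥ 1`). [folklore] -/
theorem norm_sincJ_le {R : ℝ} (hR : 1 ≤ R) {J : ℕ} (hJ : 0 < J) (s : ℂ) :
    ‖sincJ R J s‖ ≤ 1 + R ^ (-s.re) := by
  have hR0 : 0 < R := by linarith
  have hJ' : (0 : ℝ) < J := by exact_mod_cast hJ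
  rw [sincJ, norm_mul, norm_inv, Complex.norm_natCast]
  calc (J : ℝ)⁻¹ * ‖∑ j ∈ range J, (R : ℂ) ^ (-(s * j / J))‖
      ≤ (J : ℝ)⁻¹ * ∑ j ∈ range J, ‖(R : ℂ) ^ (-(s * j / J))‖ :=
        mul_le_mul_of_nonneg_left (norm_sum_le _ _) (by positivity)
    _ ≤ (J : ℝ)⁻¹ * ∑ j ∈ range J, (1 + R ^ (-s.re)) := by
        gcongr with j hj
        rw [norm_cpow_term R hR0]
        exact rpow_term_le hR (mem_range.1 hj).le hJ
    _ = 1 + R ^ (-s.re) := by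
        rw [sum_const, card_range, nsmul_eq_mul]; field_simp

/-- The terms are powers of `ξ = R^{-s/J}`: `R^{-(s j/J)} = ξ^j`. [folklore] -/
theorem cpow_term_eq_pow (R : ℝ) (s : ℂ) (j J : ℕ) :
    (R : ℂ) ^ (-(s * j / J)) = ((R : ℂ) ^ (-(s / J))) ^ j := by
  rw [← Complex.cpow_nat_mul]
  congr 1; ring

/-- **The closed form**: `sincJ R J s = (1 − R^{-s}) / (J (1 − R^{-s/J}))` when `R^{-s/J} ≠ 1`.
[folklore] -/
theorem sincJ_eq_div {R : ℝ} {J : ℕ} (hJ : 0 < J) {s : ℂ}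
    (hξ : (R : ℂ) ^ (-(s / J)) ≠ 1) :
    sincJ R J s = (1 - (R : ℂ) ^ (-s)) / ((J : ℂ) * (1 - (R : ℂ) ^ (-(s / J)))) := by
  set ξ : ℂ := (R : ℂ) ^ (-(s / J)) with hξdef
  have hsum : ∑ j ∈ range J, (R : ℂ) ^ (-(s * j / J)) = (ξ ^ J - 1) / (ξ - 1) := by
    rw [← geom_sum_eq hξ J]
    exact sum_congr rfl fun j _ => cpow_term_eq_pow R s j J
  have hξJ : ξ ^ J = (R : ℂ) ^ (-s) := by
    rw [hξdef, ← Complex.cpow_nat_mul]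
    congr 1
    have hJ' : (J : ℂ) ≠ 0 := by exact_mod_cast hJ.ne'
    field_simp
  rw [sincJ, hsum, hξJ]
  have h1 : ξ - 1 ≠ 0 := sub_ne_zero.2 hξ
  have h2 : 1 - ξ ≠ 0 := sub_ne_zero.2 (Ne.symm hξ)
  have hJ' : (J : ℂ) ≠ 0 := by exact_mod_cast hJ.ne'
  field_simp
  ring

/-- `‖1 − e^{-z}‖ ≥ ‖z‖/2` for `‖z‖ ≤ 1/2`. [folklore] -/
theorem norm_one_sub_exp_neg_ge {z : ℂ} (hz : ‖z‖ ≤ 1 / 2) : ‖z‖ / 2 ≤ ‖1 - Complex.exp (-z)‖ := by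
  have hz1 : ‖-z‖ ≤ 1 := by rw [norm_neg]; linarith
  have h := Complex.norm_exp_sub_one_sub_id_le hz1
  rw [norm_neg] at h
  -- `exp(-z) - 1 = -z + E`, `‖E‖ ≤ ‖z‖²`
  have h1 : ‖Complex.exp (-z) - 1‖ ≥ ‖z‖ - ‖z‖ ^ 2 := by
    have := norm_sub_norm_le (-z) (-(Complex.exp (-z) - 1 - -z))
    rw [norm_neg, norm_neg, show -z - -(Complex.exp (-z) - 1 - -z) = Complex.exp (-z) - 1 by ring] at this
    linarith
  have h2 : ‖1 - Complex.exp (-z)‖ = ‖Complex.exp (-z) - 1‖ := norm_sub_rev _ _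
  rw [h2]
  nlinarith [norm_nonneg z]

/-- **The decay of `sincJ`**: for `R > 1`, `J ≥ 1` and `‖s‖ log R ≤ J/2`,
`‖sincJ R J s‖ ≤ 2 (1 + R^{-re s}) / (‖s‖ log R)`. [folklore] -/
theorem norm_sincJ_le_inv {R : ℝ} (hR : 1 < R) {J : ℕ} (hJ : 0 < J) {s : ℂ} (hs : s ≠ 0)
    (hsJ : ‖s‖ * Real.log R ≤ J / 2) :
    ‖sincJ R J s‖ ≤ 2 * (1 + R ^ (-s.re)) / (‖s‖ * Real.log R) := by
  have hR0 : 0 < R := by linarith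
  have hlogR : 0 < Real.log R := Real.log_pos hR
  have hJ' : (0 : ℝ) < J := by exact_mod_cast hJ
  -- `ξ = R^{-s/J} = exp(-z)`, `z = s log R / J`
  set z : ℂ := s * (Real.log R : ℂ) / J with hzdef
  have hξ : (R : ℂ) ^ (-(s / J)) = Complex.exp (-z) := by
    rw [Complex.cpow_def_of_ne_zero (by exact_mod_cast hR0.ne'), ← Complex.ofReal_log hR0.le, hzdef]
    congr 1; ring
  have hz : ‖z‖ = ‖s‖ * Real.log R / J := by
    rw [hzdef, norm_div, norm_mul, Complex.norm_real, Complex.norm_natCast, Real.norm_of_nonneg hlogR.le]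
  have hz12 : ‖z‖ ≤ 1 / 2 := by
    rw [hz, div_le_iff₀ hJ']; linarith
  have hz0 : 0 < ‖z‖ := by rw [hz]; exact div_pos (mul_pos (norm_pos_iff.2 hs) hlogR) hJ'
  have hden := norm_one_sub_exp_neg_ge hz12
  have hξ1 : (R : ℂ) ^ (-(s / J)) ≠ 1 := by
    intro h
    rw [hξ] at h
    rw [h, sub_self, norm_zero] at hden
    linarith
  rw [sincJ_eq_div hJ hξ1, norm_div, norm_mul, Complex.norm_natCast, hξ]
  have hnum : ‖1 - (R : ℂ) ^ (-s)‖ ≤ 1 + R ^ (-s.re) := by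
    calc ‖1 - (R : ℂ) ^ (-s)‖ ≤ ‖(1 : ℂ)‖ + ‖(R : ℂ) ^ (-s)‖ := norm_sub_le _ _
      _ = 1 + R ^ (-s.re) := by
          rw [norm_one, Complex.norm_cpow_eq_rpow_re_of_pos hR0, Complex.neg_re]
  have hden' : (J : ℝ) * (‖z‖ / 2) ≤ J * ‖1 - Complex.exp (-z)‖ :=
    mul_le_mul_of_nonneg_left hden hJ'.le
  have hJz : (J : ℝ) * (‖z‖ / 2) = ‖s‖ * Real.log R / 2 := by
    rw [hz]; field_simp
  rw [hJz] at hden'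
  have hpos : 0 < ‖s‖ * Real.log R / 2 := by positivity
  calc ‖1 - (R : ℂ) ^ (-s)‖ / (J * ‖1 - Complex.exp (-z)‖)
      ≤ (1 + R ^ (-s.re)) / (‖s‖ * Real.log R / 2) :=
        div_le_div₀ (by positivity) hnum hpos hden'
    _ = 2 * (1 + R ^ (-s.re)) / (‖s‖ * Real.log R) := by field_simp

/-- The combined bound on the closed right half-plane: for `R > 1`, `J ≥ 1`, `re s ≥ 0` and
`‖s‖ log R ≤ J/2`: `‖sincJ R J s‖ ≤ min 2 (4 / (‖s‖ log R))`. [folklore] -/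
theorem norm_sincJ_le_min {R : ℝ} (hR : 1 < R) {J : ℕ} (hJ : 0 < J) {s : ℂ} (hs : s ≠ 0)
    (hre : 0 ≤ s.re) (hsJ : ‖s‖ * Real.log R ≤ J / 2) :
    ‖sincJ R J s‖ ≤ min 2 (4 / (‖s‖ * Real.log R)) := by
  have hR0 : 0 < R := by linarith
  have hpow : R ^ (-s.re) ≤ 1 := Real.rpow_le_one_of_one_le_of_nonpos hR.le (by linarith)
  refine le_min ?_ ?_
  · have := norm_sincJ_le hR.le hJ s; linarith
  · refine (norm_sincJ_le_inv hR hJ hs hsJ).trans ?_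
    have hden : 0 < ‖s‖ * Real.log R := mul_pos (norm_pos_iff.2 hs) (Real.log_pos hR)
    rw [div_le_div_iff_of_pos_right hden]
    linarith

/-! ### The scale-averaged main term -/

/-- `(X R^{-t})^w = X^w R^{-t w}` for `X, R > 0`, real `t`. [folklore] -/
theorem cpow_mul_rpow (X R : ℝ) (hX : 0 < X) (hR : 0 < R) (t : ℝ) (w : ℂ) :
    (((X * R ^ (-t) : ℝ)) : ℂ) ^ w = (X : ℂ) ^ w * (R : ℂ) ^ (-((t : ℂ) * w)) := by
  have hRt : 0 < R ^ (-t) := Real.rpow_pos_of_pos hR _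
  rw [Complex.ofReal_mul, Complex.mul_cpow_ofReal_nonneg hX.le hRt.le]
  congr 1
  have h1 : ((R ^ (-t) : ℝ) : ℂ) = Complex.exp (((-t * Real.log R : ℝ)) : ℂ) := by
    rw [Real.rpow_def_of_pos hR, Complex.ofReal_exp]; push_cast; ring_nf
  have hpi := Real.pi_pos
  rw [h1, Complex.cpow_def_of_ne_zero (Complex.exp_ne_zero _),
    Complex.log_exp (by simp; linarith) (by simp; linarith),
    Complex.cpow_def_of_ne_zero (by exact_mod_cast hR.ne'), ← Complex.ofReal_log hR.le]
  congr 1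
  push_cast
  ring


/-- The exponent `(j + j')/J` of the scale `R^{-(j+j')/J}`. [folklore] -/
def scaleExp (j j' J : ℕ) : ℝ := ((j + j' : ℕ) : ℝ) / J

/-- `0 ≤ (j+j')/J`. [folklore] -/
theorem scaleExp_nonneg (j j' J : ℕ) : 0 ≤ scaleExp j j' J := by
  unfold scaleExp; positivity

/-- `(j+j')/J ≤ 2` for `j, j' < J`. [folklore] -/
theorem scaleExp_le_two {j j' J : ℕ} (hj : j < J) (hj' : j' < J) : scaleExp j j' J ≤ 2 := by
  unfold scaleExp
  have hJ : (0 : ℝ) < J := by exact_mod_cast (Nat.zero_le j).trans_lt hj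
  rw [div_le_iff₀ hJ]
  have h1 : (j : ℝ) ≤ J := by exact_mod_cast hj.le
  have h2 : (j' : ℝ) ≤ J := by exact_mod_cast hj'.le
  push_cast; linarith

/-- `R^{-(t w)}` splits over `t = (j + j')/J`: `R^{-((j+j')/J · w)} = R^{-(w j/J)} R^{-(w j'/J)}`.
[folklore] -/
theorem cpow_neg_split (R : ℝ) (hR : 0 < R) (w : ℂ) (j j' J : ℕ) :
    (R : ℂ) ^ (-((scaleExp j j' J : ℂ) * w)) =
      (R : ℂ) ^ (-(w * j / J)) * (R : ℂ) ^ (-(w * j' / J)) := by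
  rw [← Complex.cpow_add _ _ (by exact_mod_cast hR.ne')]
  congr 1
  unfold scaleExp
  push_cast
  ring

/-- **The averaged power**: `Σ_{j,j'<J} (X R^{-(j+j')/J})^w = X^w · J² · sincJ(w)²`. [folklore] -/
theorem sum_sum_cpow_scaled (X R : ℝ) (hX : 0 < X) (hR : 0 < R) (J : ℕ) (hJ : 0 < J) (w : ℂ) :
    ∑ j ∈ range J, ∑ j' ∈ range J, (((X * R ^ (-scaleExp j j' J) : ℝ)) : ℂ) ^ w =
      (X : ℂ) ^ w * ((J : ℂ) ^ 2 * sincJ R J w ^ 2) := by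
  have hJ' : (J : ℂ) ≠ 0 := by exact_mod_cast hJ.ne'
  have hterm : ∀ j j' : ℕ, (((X * R ^ (-scaleExp j j' J) : ℝ)) : ℂ) ^ w =
      (X : ℂ) ^ w * ((R : ℂ) ^ (-(w * j / J)) * (R : ℂ) ^ (-(w * j' / J))) := by
    intro j j'
    rw [cpow_mul_rpow X R hX hR _ w, cpow_neg_split R hR w j j' J]
  simp_rw [hterm]
  have hprod : (∑ j ∈ range J, (R : ℂ) ^ (-(w * j / J))) * (∑ j' ∈ range J, (R : ℂ) ^ (-(w * j' / J))) =
      (J : ℂ) ^ 2 * sincJ R J w ^ 2 := by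
    rw [sincJ]; field_simp
  rw [← hprod, sum_mul_sum, mul_sum]
  refine sum_congr rfl fun i _ => ?_
  rw [mul_sum]

/-! ### The scale-averaged Gram sum -/

variable {q : ℕ}

/-- The averaged Gram sum `G̃(κ) = J⁻² Σ_{j,j'<J} G_{X_{jj'},Y_{jj'}}(κ)`,
`X_{jj'} = X R^{-(j+j')/J}`, `Y_{jj'} = Y R^{-(j+j')/J}`. [cite: HeathBrown1992PLMS, §11 (11.15)] -/
def gramAvg (W X Y R : ℝ) (J : ℕ) (κ : ℂ) : ℂ :=
  ((J : ℂ) ^ 2)⁻¹ * ∑ j ∈ range J, ∑ j' ∈ range J,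
    gramSum (q := q) W (X * R ^ (-scaleExp j j' J)) (Y * R ^ (-scaleExp j j' J)) κ

/-- The remainder integral of `gramSum_eq` is at most `512 K₂(Y)`. [cite: HeathBrown1992PLMS, §11 (11.16)] -/
theorem norm_gramRemainder_le [NeZero q] {W X Y : ℝ} (hX : 0 < X) (hY : 0 < Y) (hW : 1 < W)
    (hYX : Y ≤ X) {κ : ℂ} (hκ : 1 / 2 ≤ κ.re) (hκ1 : κ.re ≤ 1) :
    ‖(1 / (2 * π) : ℂ) * ∫ y : ℝ, gramIntegrand (q := q) W X Y κ ((-1 / 4 : ℝ) + y * I)‖ ≤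
      512 * (4096 * π ^ 2 / 3 * 2 ^ q.primeFactors.card * (1 + ‖κ‖) * ((⌊W⌋₊ : ℝ) * ⌊W⌋₊) *
        Y ^ (-(1 / 4 : ℝ))) := by
  set K : ℝ := 4096 * π ^ 2 / 3 * 2 ^ q.primeFactors.card * (1 + ‖κ‖) * ((⌊W⌋₊ : ℝ) * ⌊W⌋₊) *
    Y ^ (-(1 / 4 : ℝ)) with hK
  have hK0 : 0 ≤ K := by rw [hK]; positivity
  have hbound : ∀ y : ℝ, ‖gramIntegrand (q := q) W X Y κ ((-1 / 4 : ℝ) + y * I)‖ ≤ K * 1024 * (1 + y ^ 2)⁻¹ := by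
    intro y
    calc ‖gramIntegrand (q := q) W X Y κ ((-1 / 4 : ℝ) + y * I)‖
        ≤ K * ((1 + |y|) ^ (5 / 2 : ℝ) * Real.exp (-(π * |y|) / 2)) :=
          norm_gramIntegrand_left_le hX hY hW hYX hκ hκ1 y
      _ ≤ K * (1024 * (1 + y ^ 2)⁻¹) := mul_le_mul_of_nonneg_left (rpow_mul_exp_le_inv_one_add_sq y) hK0
      _ = K * 1024 * (1 + y ^ 2)⁻¹ := by ring
  have hint : ‖∫ y : ℝ, gramIntegrand (q := q) W X Y κ ((-1 / 4 : ℝ) + y * I)‖ ≤ K * 1024 * π := by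
    calc ‖∫ y : ℝ, gramIntegrand (q := q) W X Y κ ((-1 / 4 : ℝ) + y * I)‖
        ≤ ∫ y : ℝ, K * 1024 * (1 + y ^ 2)⁻¹ :=
          MeasureTheory.norm_integral_le_of_norm_le ((integrable_inv_one_add_sq).const_mul _)
            (Filter.Eventually.of_forall hbound)
      _ = K * 1024 * π := by rw [MeasureTheory.integral_const_mul, integral_univ_inv_one_add_sq]
  have hc : ‖(1 / (2 * π) : ℂ)‖ = 1 / (2 * π) := by
    rw [show (1 / (2 * π) : ℂ) = ((1 / (2 * π) : ℝ) : ℂ) by push_cast; ring, Complex.norm_real,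
      Real.norm_of_nonneg (by positivity)]
  rw [norm_mul, hc]
  calc 1 / (2 * π) * ‖∫ y : ℝ, gramIntegrand (q := q) W X Y κ ((-1 / 4 : ℝ) + y * I)‖
      ≤ 1 / (2 * π) * (K * 1024 * π) := mul_le_mul_of_nonneg_left hint (by positivity)
    _ = 512 * K := by field_simp; ring

/-- **The averaged Gram sum**: for `1 < W`, `1 ≤ R`, `R² ≤ Y ≤ X`, `J ≥ 1`, `1/2 ≤ re κ < 1`:
`‖G̃(κ)‖ ≤ (φ(q)/q) ‖D_q(1)‖ ‖(X^{w₁} − Y^{w₁})Γ(w₁)‖ ‖sincJ(w₁)‖² + 512 K₂(Y/R²)`, `w₁ = 1 − κ`.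
[cite: HeathBrown1992PLMS, §11 (11.15)–(11.17)] -/
theorem norm_gramAvg_le [NeZero q] (hq : q ≠ 0) {W X Y R : ℝ} {J : ℕ} (hW : 1 < W) (hR : 1 ≤ R)
    (hY : R ^ 2 ≤ Y) (hYX : Y ≤ X) (hJ : 0 < J) {κ : ℂ} (hκ : 1 / 2 ≤ κ.re) (hκ1 : κ.re < 1) :
    ‖gramAvg (q := q) W X Y R J κ‖ ≤
      (q.totient : ℝ) / q * ‖Fpoly (1 : DirichletCharacter ℂ q) 1 W W 1‖ *
          ‖((X : ℂ) ^ (1 - κ) - (Y : ℂ) ^ (1 - κ)) * Complex.Gamma (1 - κ)‖ * ‖sincJ R J (1 - κ)‖ ^ 2 +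
        512 * (4096 * π ^ 2 / 3 * 2 ^ q.primeFactors.card * (1 + ‖κ‖) * ((⌊W⌋₊ : ℝ) * ⌊W⌋₊) *
          (R ^ (1 / 2 : ℝ) * Y ^ (-(1 / 4 : ℝ)))) := by
  have hR0 : 0 < R := by linarith
  have hR2 : 1 ≤ R ^ 2 := one_le_pow₀ hR
  have hY1 : 1 ≤ Y := hR2.trans hY
  have hY0 : 0 < Y := by linarith
  have hX0 : 0 < X := by linarith
  have hJ' : (J : ℂ) ≠ 0 := by exact_mod_cast hJ.ne'
  -- the scales
  set t : ℕ → ℕ → ℝ := fun j j' => scaleExp j j' J with ht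
  have ht0 : ∀ j j', 0 ≤ t j j' := fun j j' => scaleExp_nonneg j j' J
  have ht2 : ∀ j ∈ range J, ∀ j' ∈ range J, t j j' ≤ 2 := fun j hj j' hj' =>
    scaleExp_le_two (mem_range.1 hj) (mem_range.1 hj')
  have hRt : ∀ j ∈ range J, ∀ j' ∈ range J, R ^ (-(2 : ℝ)) ≤ R ^ (-t j j') ∧ R ^ (-t j j') ≤ 1 := by
    intro j hj j' hj'
    exact ⟨Real.rpow_le_rpow_of_exponent_le hR (by linarith [ht2 j hj j' hj']),
      Real.rpow_le_one_of_one_le_of_nonpos hR (by linarith [ht0 j j'])⟩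
  -- per-scale data
  have hscale : ∀ j ∈ range J, ∀ j' ∈ range J,
      0 < X * R ^ (-t j j') ∧ 0 < Y * R ^ (-t j j') ∧ 1 ≤ Y * R ^ (-t j j') ∧
        Y * R ^ (-t j j') ≤ X * R ^ (-t j j') ∧ (Y * R ^ (-t j j')) ^ (-(1 / 4 : ℝ)) ≤ R ^ (1 / 2 : ℝ) * Y ^ (-(1 / 4 : ℝ)) := by
    intro j hj j' hj'
    obtain ⟨hlo, hhi⟩ := hRt j hj j' hj'
    have hpos : 0 < R ^ (-t j j') := Real.rpow_pos_of_pos hR0 _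
    have hR2' : R ^ (-(2 : ℝ)) = (R ^ 2)⁻¹ := by
      rw [Real.rpow_neg hR0.le, show (2 : ℝ) = ((2 : ℕ) : ℝ) by norm_num, Real.rpow_natCast]
    refine ⟨mul_pos hX0 hpos, mul_pos hY0 hpos, ?_, mul_le_mul_of_nonneg_right hYX hpos.le, ?_⟩
    · calc (1 : ℝ) = R ^ 2 * (R ^ 2)⁻¹ := by field_simp
        _ ≤ Y * R ^ (-t j j') := by
            rw [← hR2']; exact mul_le_mul hY hlo (by positivity) hY0.le
    · -- `(Y R^{-t})^{-1/4} ≤ (Y/R²)^{-1/4} = R^{1/2} Y^{-1/4}`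
      have h1 : Y * R ^ (-(2 : ℝ)) ≤ Y * R ^ (-t j j') := mul_le_mul_of_nonneg_left hlo hY0.le
      have h2 : (Y * R ^ (-t j j')) ^ (-(1 / 4 : ℝ)) ≤ (Y * R ^ (-(2 : ℝ))) ^ (-(1 / 4 : ℝ)) :=
        Real.rpow_le_rpow_of_nonpos (by positivity) h1 (by norm_num)
      refine h2.trans (le_of_eq ?_)
      rw [Real.mul_rpow hY0.le (by positivity), ← Real.rpow_mul hR0.le]
      norm_num
      ring
  -- expand
  set Res : ℂ := eulerQ q 1 * Fpoly (1 : DirichletCharacter ℂ q) 1 W W 1 with hRes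
  set Rem : ℕ → ℕ → ℂ := fun j j' => (1 / (2 * π) : ℂ) *
    ∫ y : ℝ, gramIntegrand (q := q) W (X * R ^ (-t j j')) (Y * R ^ (-t j j')) κ ((-1 / 4 : ℝ) + y * I) with hRem
  have hexp : gramAvg (q := q) W X Y R J κ =
      Res * ((((X : ℂ) ^ (1 - κ) - (Y : ℂ) ^ (1 - κ)) * Complex.Gamma (1 - κ)) * sincJ R J (1 - κ) ^ 2) +
        ((J : ℂ) ^ 2)⁻¹ * ∑ j ∈ range J, ∑ j' ∈ range J, Rem j j' := by
    have hsum : ∑ j ∈ range J, ∑ j' ∈ range J,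
        gramSum (q := q) W (X * R ^ (-t j j')) (Y * R ^ (-t j j')) κ =
        ∑ j ∈ range J, ∑ j' ∈ range J,
          (Res * (((((X * R ^ (-t j j') : ℝ)) : ℂ) ^ (1 - κ) - (((Y * R ^ (-t j j') : ℝ)) : ℂ) ^ (1 - κ)) *
            Complex.Gamma (1 - κ)) + Rem j j') := by
      refine sum_congr rfl fun j hj => sum_congr rfl fun j' hj' => ?_
      obtain ⟨hX', hY', hY1', hYX', -⟩ := hscale j hj j' hj'
      rw [gramSum_eq hX' hY' hW hY1' hYX' hκ hκ1]
    have hX2 := sum_sum_cpow_scaled X R hX0 hR0 J hJ (1 - κ)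
    have hY2 := sum_sum_cpow_scaled Y R hY0 hR0 J hJ (1 - κ)
    simp only [ht] at hsum ⊢
    rw [gramAvg, hsum]
    simp only [sum_add_distrib]
    rw [mul_add]
    congr 1
    have : ∑ x ∈ range J, ∑ x_1 ∈ range J,
        Res * (((((X * R ^ (-scaleExp x x_1 J) : ℝ)) : ℂ) ^ (1 - κ) -
          (((Y * R ^ (-scaleExp x x_1 J) : ℝ)) : ℂ) ^ (1 - κ)) * Complex.Gamma (1 - κ)) =
        Res * (((∑ x ∈ range J, ∑ x_1 ∈ range J, (((X * R ^ (-scaleExp x x_1 J) : ℝ)) : ℂ) ^ (1 - κ)) -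
          (∑ x ∈ range J, ∑ x_1 ∈ range J, (((Y * R ^ (-scaleExp x x_1 J) : ℝ)) : ℂ) ^ (1 - κ))) *
            Complex.Gamma (1 - κ)) := by
      symm
      rw [← sum_sub_distrib]
      simp_rw [← sum_sub_distrib]
      rw [sum_mul, mul_sum]
      refine sum_congr rfl fun x _ => ?_
      rw [sum_mul, mul_sum]
    rw [this, hX2, hY2]
    field_simp
  -- bound
  rw [hexp]
  refine (norm_add_le _ _).trans (add_le_add ?_ ?_)
  · rw [norm_mul, hRes, norm_mul, norm_mul, norm_pow, eulerQ_one hq, Complex.norm_real,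
      Real.norm_of_nonneg (by positivity)]
    ring_nf
    rfl
  · rw [norm_mul, norm_inv, norm_pow, Complex.norm_natCast]
    set K' : ℝ := 512 * (4096 * π ^ 2 / 3 * 2 ^ q.primeFactors.card * (1 + ‖κ‖) * ((⌊W⌋₊ : ℝ) * ⌊W⌋₊) *
      (R ^ (1 / 2 : ℝ) * Y ^ (-(1 / 4 : ℝ)))) with hK'
    have hRemle : ∀ j ∈ range J, ∀ j' ∈ range J, ‖Rem j j'‖ ≤ K' := by
      intro j hj j' hj'
      obtain ⟨hX', hY', -, hYX', hpow⟩ := hscale j hj j' hj'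
      refine (norm_gramRemainder_le hX' hY' hW hYX' hκ hκ1.le).trans ?_
      rw [hK']
      gcongr
    have hJ2 : (0 : ℝ) < (J : ℝ) ^ 2 := by positivity
    calc ((J : ℝ) ^ 2)⁻¹ * ‖∑ j ∈ range J, ∑ j' ∈ range J, Rem j j'‖
        ≤ ((J : ℝ) ^ 2)⁻¹ * ∑ j ∈ range J, ∑ j' ∈ range J, K' := by
          refine mul_le_mul_of_nonneg_left ?_ (by positivity)
          refine (norm_sum_le _ _).trans (sum_le_sum fun j hj => (norm_sum_le _ _).trans (sum_le_sum fun j' hj' => hRemle j hj j' hj'))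
      _ = K' := by
          rw [sum_const, sum_const, card_range, nsmul_eq_mul, nsmul_eq_mul]; field_simp


/-! ### The kernel majorants (three ranges of `τ = im w₁`) -/

/-- The kernel `g(w) = ‖(X^w − Y^w)Γ(w)‖ ‖sincJ(w)‖²`. [folklore] -/
def kernel (X Y R : ℝ) (J : ℕ) (w : ℂ) : ℝ :=
  ‖((X : ℂ) ^ w - (Y : ℂ) ^ w) * Complex.Gamma w‖ * ‖sincJ R J w‖ ^ 2

/-- `kernel ≥ 0`. [folklore] -/
theorem kernel_nonneg (X Y R : ℝ) (J : ℕ) (w : ℂ) : 0 ≤ kernel X Y R J w := by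
  unfold kernel; positivity

/-- **Small `τ`** (`|im w| ≤ 1`, `0 < re w ≤ 1`, `1 ≤ Y ≤ X`, `R ≥ 1`, `J ≥ 1`):
`g(w) ≤ 192π² log(X/Y) X^{re w}` (`16π² · 2^{3/2} · 4 ≤ 192π²`). [folklore] -/
theorem kernel_le_small {X Y R : ℝ} {J : ℕ} (hY1 : 1 ≤ Y) (hYX : Y ≤ X) (hR : 1 ≤ R) (hJ : 0 < J)
    {w : ℂ} (hw : 0 < w.re) (hw1 : w.re ≤ 1) (him : |w.im| ≤ 1) :
    kernel X Y R J w ≤ 192 * π ^ 2 * Real.log (X / Y) * X ^ w.re := by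
  have hX1 : 1 ≤ X := hY1.trans hYX
  have h1 := norm_cpow_sub_cpow_mul_Gamma_le_log hY1 hYX hw hw1
  have hs : ‖sincJ R J w‖ ≤ 2 := by
    have := norm_sincJ_le hR hJ w
    have : R ^ (-w.re) ≤ 1 := Real.rpow_le_one_of_one_le_of_nonpos hR (by linarith)
    linarith
  have hs2 : ‖sincJ R J w‖ ^ 2 ≤ 4 := by nlinarith [norm_nonneg (sincJ R J w)]
  have hτ : (1 + |w.im|) ^ (3 / 2 : ℝ) * Real.exp (-(π * |w.im|) / 2) ≤ 3 := by
    have h2 : (1 + |w.im|) ^ (3 / 2 : ℝ) ≤ (2 : ℝ) ^ (3 / 2 : ℝ) :=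
      Real.rpow_le_rpow (by positivity) (by linarith) (by norm_num)
    have h3 : (2 : ℝ) ^ (3 / 2 : ℝ) ≤ 3 := by
      have : (2 : ℝ) ^ (3 / 2 : ℝ) = Real.sqrt 8 := by
        rw [show (8 : ℝ) = 2 ^ (3 : ℝ) by norm_num, Real.sqrt_eq_rpow, ← Real.rpow_mul (by norm_num)]
        norm_num
      rw [this]
      rw [Real.sqrt_le_left (by norm_num)]; norm_num
    have h4 : Real.exp (-(π * |w.im|) / 2) ≤ 1 := Real.exp_le_one_iff.2 (by
      have := Real.pi_pos; have := abs_nonneg w.im; nlinarith)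
    calc (1 + |w.im|) ^ (3 / 2 : ℝ) * Real.exp (-(π * |w.im|) / 2) ≤ 3 * 1 :=
          mul_le_mul (h2.trans h3) h4 (Real.exp_nonneg _) (by norm_num)
      _ = 3 := by ring
  have hlog : 0 ≤ Real.log (X / Y) := Real.log_nonneg ((one_le_div (by linarith)).2 hYX)
  have hXw : 0 ≤ X ^ w.re := by positivity
  unfold kernel
  calc ‖((X : ℂ) ^ w - (Y : ℂ) ^ w) * Complex.Gamma w‖ * ‖sincJ R J w‖ ^ 2
      ≤ (16 * π ^ 2 * (1 + |w.im|) ^ (3 / 2 : ℝ) * Real.exp (-(π * |w.im|) / 2) *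
          Real.log (X / Y) * X ^ w.re) * 4 :=
        mul_le_mul h1 hs2 (by positivity) (by positivity)
    _ = 64 * π ^ 2 * ((1 + |w.im|) ^ (3 / 2 : ℝ) * Real.exp (-(π * |w.im|) / 2)) *
          (Real.log (X / Y) * X ^ w.re) := by ring
    _ ≤ 64 * π ^ 2 * 3 * (Real.log (X / Y) * X ^ w.re) := by gcongr
    _ = 192 * π ^ 2 * Real.log (X / Y) * X ^ w.re := by ring

/-- **Middle `τ`** (`0 < |im w| ≤ 1`, `0 < re w ≤ 1`, `1 ≤ Y ≤ X`, `R > 1`, `J ≥ 4 log R`):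
`g(w) ≤ 96π² X^{re w} / |im w| · (min 2 (4/(|im w| log R)))²`. [folklore] -/
theorem kernel_le_mid {X Y R : ℝ} {J : ℕ} (hY1 : 1 ≤ Y) (hYX : Y ≤ X) (hR : 1 < R) (hJ : 0 < J)
    (hJR : 4 * Real.log R ≤ J) {w : ℂ} (hw : 0 < w.re) (hw1 : w.re ≤ 1) (him : |w.im| ≤ 1)
    (him0 : w.im ≠ 0) :
    kernel X Y R J w ≤ 96 * π ^ 2 * X ^ w.re / |w.im| * (min 2 (4 / (|w.im| * Real.log R))) ^ 2 := by
  have hX1 : 1 ≤ X := hY1.trans hYX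
  have hlogR : 0 < Real.log R := Real.log_pos hR
  have hw0 : w ≠ 0 := by intro h; rw [h] at hw; simp at hw
  have hτ0 : 0 < |w.im| := abs_pos.2 him0
  have hnorm_ge : |w.im| ≤ ‖w‖ := Complex.abs_im_le_norm w
  have hnorm_le : ‖w‖ ≤ 2 := by
    calc ‖w‖ ≤ |w.re| + |w.im| := Complex.norm_le_abs_re_add_abs_im w
      _ ≤ 1 + 1 := by rw [abs_of_pos hw]; exact add_le_add hw1 him
      _ = 2 := by norm_num
  have h1 := norm_cpow_sub_cpow_mul_Gamma_le_inv hY1 hYX hw hw1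
  have hsJ : ‖w‖ * Real.log R ≤ J / 2 := by nlinarith
  have hs := norm_sincJ_le_min hR hJ hw0 hw.le hsJ
  -- replace `‖w‖` by `|im w|` in the `sinc` bound
  have hs' : ‖sincJ R J w‖ ≤ min 2 (4 / (|w.im| * Real.log R)) := by
    refine hs.trans (min_le_min le_rfl ?_)
    exact div_le_div_of_nonneg_left (by norm_num) (mul_pos hτ0 hlogR)
      (mul_le_mul_of_nonneg_right hnorm_ge hlogR.le)
  have hmin0 : 0 ≤ min 2 (4 / (|w.im| * Real.log R)) := le_min (by norm_num) (by positivity)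
  have hs2 : ‖sincJ R J w‖ ^ 2 ≤ (min 2 (4 / (|w.im| * Real.log R))) ^ 2 :=
    pow_le_pow_left₀ (norm_nonneg _) hs' 2
  have hτ : (1 + |w.im|) ^ (3 / 2 : ℝ) * Real.exp (-(π * |w.im|) / 2) ≤ 3 := by
    have h2 : (1 + |w.im|) ^ (3 / 2 : ℝ) ≤ (2 : ℝ) ^ (3 / 2 : ℝ) :=
      Real.rpow_le_rpow (by positivity) (by linarith) (by norm_num)
    have h3 : (2 : ℝ) ^ (3 / 2 : ℝ) ≤ 3 := by
      have : (2 : ℝ) ^ (3 / 2 : ℝ) = Real.sqrt 8 := by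
        rw [show (8 : ℝ) = 2 ^ (3 : ℝ) by norm_num, Real.sqrt_eq_rpow, ← Real.rpow_mul (by norm_num)]
        norm_num
      rw [this, Real.sqrt_le_left (by norm_num)]; norm_num
    have h4 : Real.exp (-(π * |w.im|) / 2) ≤ 1 := Real.exp_le_one_iff.2 (by
      have := Real.pi_pos; have := abs_nonneg w.im; nlinarith)
    calc (1 + |w.im|) ^ (3 / 2 : ℝ) * Real.exp (-(π * |w.im|) / 2) ≤ 3 * 1 :=
          mul_le_mul (h2.trans h3) h4 (Real.exp_nonneg _) (by norm_num)
      _ = 3 := by ring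
  -- `1/‖w‖ ≤ 1/|im w|`
  have hinv : 2 * X ^ w.re / ‖w‖ ≤ 2 * X ^ w.re / |w.im| :=
    div_le_div_of_nonneg_left (by positivity) hτ0 hnorm_ge
  unfold kernel
  calc ‖((X : ℂ) ^ w - (Y : ℂ) ^ w) * Complex.Gamma w‖ * ‖sincJ R J w‖ ^ 2
      ≤ (16 * π ^ 2 * (1 + |w.im|) ^ (3 / 2 : ℝ) * Real.exp (-(π * |w.im|) / 2) *
          (2 * X ^ w.re) / ‖w‖) * (min 2 (4 / (|w.im| * Real.log R))) ^ 2 :=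
        mul_le_mul h1 hs2 (by positivity) (by positivity)
    _ = 16 * π ^ 2 * ((1 + |w.im|) ^ (3 / 2 : ℝ) * Real.exp (-(π * |w.im|) / 2)) *
          (2 * X ^ w.re / ‖w‖) * (min 2 (4 / (|w.im| * Real.log R))) ^ 2 := by ring
    _ ≤ 16 * π ^ 2 * 3 * (2 * X ^ w.re / |w.im|) * (min 2 (4 / (|w.im| * Real.log R))) ^ 2 := by
        gcongr
    _ = 96 * π ^ 2 * X ^ w.re / |w.im| * (min 2 (4 / (|w.im| * Real.log R))) ^ 2 := by ring

/-- **Large `τ`** (`|im w| ≥ 1`, `0 < re w ≤ 1`, `1 ≤ Y ≤ X`, `R ≥ 1`, `J ≥ 1`):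
`g(w) ≤ 128π² X^{re w} (1+|im w|)^{3/2} e^{-π|im w|/2}`. [folklore] -/
theorem kernel_le_large {X Y R : ℝ} {J : ℕ} (hY1 : 1 ≤ Y) (hYX : Y ≤ X) (hR : 1 ≤ R) (hJ : 0 < J)
    {w : ℂ} (hw : 0 < w.re) (hw1 : w.re ≤ 1) (him : 1 ≤ |w.im|) :
    kernel X Y R J w ≤
      128 * π ^ 2 * X ^ w.re * ((1 + |w.im|) ^ (3 / 2 : ℝ) * Real.exp (-(π * |w.im|) / 2)) := by
  have hX1 : 1 ≤ X := hY1.trans hYX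
  have hw0 : w ≠ 0 := by intro h; rw [h] at hw; simp at hw
  have hnorm_ge : |w.im| ≤ ‖w‖ := Complex.abs_im_le_norm w
  have h1 := norm_cpow_sub_cpow_mul_Gamma_le_inv hY1 hYX hw hw1
  have hs : ‖sincJ R J w‖ ≤ 2 := by
    have := norm_sincJ_le hR hJ w
    have : R ^ (-w.re) ≤ 1 := Real.rpow_le_one_of_one_le_of_nonpos hR (by linarith)
    linarith
  have hs2 : ‖sincJ R J w‖ ^ 2 ≤ 4 := by nlinarith [norm_nonneg (sincJ R J w)]
  have hinv : 2 * X ^ w.re / ‖w‖ ≤ 2 * X ^ w.re := by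
    rw [div_le_iff₀ (by linarith)]
    have : (0 : ℝ) ≤ 2 * X ^ w.re := by positivity
    nlinarith
  unfold kernel
  calc ‖((X : ℂ) ^ w - (Y : ℂ) ^ w) * Complex.Gamma w‖ * ‖sincJ R J w‖ ^ 2
      ≤ (16 * π ^ 2 * (1 + |w.im|) ^ (3 / 2 : ℝ) * Real.exp (-(π * |w.im|) / 2) *
          (2 * X ^ w.re) / ‖w‖) * 4 :=
        mul_le_mul h1 hs2 (by positivity) (by positivity)
    _ = 64 * π ^ 2 * ((1 + |w.im|) ^ (3 / 2 : ℝ) * Real.exp (-(π * |w.im|) / 2)) *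
          (2 * X ^ w.re / ‖w‖) := by ring
    _ ≤ 64 * π ^ 2 * ((1 + |w.im|) ^ (3 / 2 : ℝ) * Real.exp (-(π * |w.im|) / 2)) * (2 * X ^ w.re) := by
        gcongr
    _ = _ := by ring

end Literature.NumberTheory.LFunctions.LFDSingle
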